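import Summits.Ventures.PercRepro2.CaseOneStarCertT1
import Summits.Ventures.PercRepro2.CaseOneGadgetUWA1OBlockII0
import Summits.Ventures.PercRepro2.CaseOneGadgetUWA1OBlockII1
import Summits.Ventures.PercRepro2.CaseOneGadgetUWA1OBlockII2
import Summits.Ventures.PercRepro2.CaseOneGadgetUWA1OBlockII3
import Summits.Ventures.PercRepro2.CaseOneGadgetUWA1OBlockII4
import Summits.Ventures.PercRepro2.CaseOneGadgetUWA1OBlockII5
import Summits.Ventures.PercRepro2.CaseOneGadgetUWA1OBlockII6
import Summits.Ventures.PercRepro2.CaseOneGadgetUWA1OBlockII7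
import Summits.Ventures.PercRepro2.CaseOneGadgetUWA1OBlockII8
import Summits.Ventures.PercRepro2.CaseOneGadgetUWA1OBlockII9
import Summits.Ventures.PercRepro2.CaseOneGadgetUWA1OBlockII10
import Summits.Ventures.PercRepro2.CaseOneGadgetUWA1OBlockII11
import Summits.Ventures.PercRepro2.CaseOneGadgetUWA1OBlockII12
import Summits.Ventures.PercRepro2.CaseOneGadgetUWA1OBlockII13
import Summits.Ventures.PercRepro2.CaseOneGadgetUWA1OBlockII14

/-!
# The gadget `u ~ {w, a₁, o}`, `w ~ {u, a₂, b}` (uwa1o): the cell certificates of `iiAO5` (part 33e)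
(blind cell PercRepro2, p1 g34; the fourth gadget anchor of the six-form calculus — all six forms of the uwa1o gadget
as plain SFacts-cone certificate chains, generated by mining/p1/g34/uwa1o/genu.py = p1 g33's gent_uwa1.py / g25's
geno.py re-targeted; P1-G33 §6–§6″, P1-G34)

Each `eBAOII ijk kl` is a nonnegative combination of `(pairwise atom) × (cell)` and cubic cell monomials — or, for the degree-4 ones, `M × eBAOII ijk kl` (`M = Σ cᵢ` the total cell mass) is a nonnegative combination of `(atom) × (cell) × (cell)` and quartic cell monomials, then `SFacts.nonneg_of_sum_mul` (`CaseOneStarCertT1`) — exact LP certificates (kit j318477, every certificate re-verified exactly; data/p1/g33/gcerts_ii_uwa1o.json, form `ii`), here as exact `linear_combination`s over `SFacts` (the rational coefficients cleared by their common denominator). -/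

namespace Summit.Ventures.PercRepro2

namespace CaseOne

section CertAOII33e
variable {R : Type*} [Field R] [LinearOrder R] [IsStrictOrderedRing R]

set_option maxHeartbeats 0 in
/-- `eBAOII22331 ≥ 0`: the combination is identically zero (`ring`). -/
lemma eBAOII22331_nonneg (m : SCells R) (_hf : SFacts m) : 0 ≤ eBAOII22331 m := by
  have h : eBAOII22331 m = 0 := by
    unfold eBAOII22331 cBAOII00131 cBAOII00231 cBAOII01031 cBAOII01131 cBAOII01231 cBAOII01331 cBAOII02031 cBAOII02131 cBAOII02231 cBAOII02331 cBAOII10131 cBAOII10231 cBAOII10331 cBAOII11031 cBAOII11131 cBAOII11231 cBAOII11331 cBAOII12031 cBAOII12131 cBAOII12231 cBAOII12331 cBAOII20131 cBAOII20231 cBAOII20331 cBAOII21031 cBAOII21131 cBAOII21231 cBAOII21331 cBAOII22031 cBAOII22131 cBAOII22231 cBAOII22331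
    ring
  linarith [h]

set_option maxHeartbeats 0 in
/-- `eBAOII22332 ≥ 0`: the combination is identically zero (`ring`). -/
lemma eBAOII22332_nonneg (m : SCells R) (_hf : SFacts m) : 0 ≤ eBAOII22332 m := by
  have h : eBAOII22332 m = 0 := by
    unfold eBAOII22332 cBAOII00132 cBAOII00232 cBAOII01032 cBAOII01132 cBAOII01232 cBAOII01332 cBAOII02032 cBAOII02132 cBAOII02232 cBAOII02332 cBAOII10132 cBAOII10232 cBAOII10332 cBAOII11032 cBAOII11132 cBAOII11232 cBAOII11332 cBAOII12032 cBAOII12132 cBAOII12232 cBAOII12332 cBAOII20132 cBAOII20232 cBAOII20332 cBAOII21032 cBAOII21132 cBAOII21232 cBAOII21332 cBAOII22032 cBAOII22132 cBAOII22232 cBAOII22332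
    ring
  linarith [h]

end CertAOII33e

end CaseOne

end Summit.Ventures.PercRepro2
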